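import Summits.AtomisticToContinuum.Crystallization.Theorems.PalmUnimodularRigidityShellsToBarlowChartDefs
import Summits.AtomisticToContinuum.Crystallization.Theorems.PalmUnimodularRigidityShellsToBarlowChartDeckTransitiveA

/-!
# Deck transitivity of bond coverings by the model (stub `stub_deckTransitive`)

Line `develop-the-model-growth-descent` (crux `ShellsToBarlowChart`, stmt-AtomisticToContinuum-9227),
the universal-cover step of the growth descent: for a bond covering `Ψ : B → S` of an ARBITRARY
set `S` by the model `B = barlowStacking 1 √(2/3) s` (`IsBondCovering`: onto, star-bijective,
link-faithful), a coincidence `Ψ p = Ψ p'`, `p ≠ p'`, is realised by a fixed-point-free contact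
automorphism `σ` of `B` over `Ψ` with `σ p = p'` (`stub_deckTransitive`).

The abstract construction (unique lifting of the unit steps of `ℤ³`, commuting lifted moves,
integration in `Equiv.Perm`, uniqueness of lifts) is file `…DeckTransitiveA.lean`; here it is
specialised to the model through the indexing `t = (k, i, j) ↦ barlowPos 1 √(2/3) s k i j`
(injective by `le_dist_barlowPos`) and the contact table `BarlowCoordination.dist_barlowPos_eq_iff`:
the six unit steps are contacts (`deck_unit`), the three commuting unit squares have a contact
diagonal (`deck_diag`), and every contact is a word of length `≤ 2` in the unit steps
(`deck_gen`).
-/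

noncomputable section

namespace Summit.AtomisticToContinuum.Crystallization.Theorems.PalmUnimodularRigidityShellsToBarlowChart

open Literature.MathematicalPhysics.StatisticalMechanics

/-- Euclidean `3`-space. -/
local notation "E3" => EuclideanSpace ℝ (Fin 3)

/-- The six unit steps `±e₁, ±e₂, ±e₃` of the index lattice `ℤ³` (layer, row, column). -/
local notation "U6" => ({((1 : ℤ), (0 : ℤ), (0 : ℤ)), (-1, 0, 0), (0, 1, 0), (0, -1, 0), (0, 0, 1),
  (0, 0, -1)} : Finset (ℤ × ℤ × ℤ))

/-- The site of the model with index `t = (k, i, j)` (layer, row, column). -/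
local notation "bpos[" s ", " t "]" =>
  barlowPos 1 (Real.sqrt (2 / 3)) s (Prod.fst t) (Prod.fst (Prod.snd t)) (Prod.snd (Prod.snd t))

/-! ## The model: contacts of `B = barlowStacking 1 √(2/3) s` in index form -/

/-- Contacts of the model in index form (`BarlowCoordination.dist_barlowPos_eq_iff`). [folklore] -/
theorem deck_adj_iff {s : ℤ → ℤ} (hs : IsHaggSeq s) (t u : ℤ × ℤ × ℤ) :
    dist bpos[s, t] bpos[s, u] = 1 ↔
      (u.1 = t.1 ∧ (t.2.1 - u.2.1, t.2.2 - u.2.2) ∈ sixOffsets) ∨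
      (u.1 = t.1 + 1 ∧ (t.2.1 - u.2.1, t.2.2 - u.2.2) ∈ threeOffsets (-s t.1)) ∨
      (u.1 = t.1 - 1 ∧ (t.2.1 - u.2.1, t.2.2 - u.2.2) ∈ threeOffsets (s (t.1 - 1))) :=
  dist_barlowPos_eq_iff hs one_pos (by rw [Real.sq_sqrt (by norm_num)]; norm_num) _ _ _ _ _ _

/-- The six unit steps are contacts (`V, I, J` and their inverses). [folklore] -/
theorem deck_unit {s : ℤ → ℤ} (hs : IsHaggSeq s) (t : ℤ × ℤ × ℤ) :
    ∀ v ∈ U6, dist bpos[s, t] bpos[s, t + v] = 1 := by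
  have h3 : ∀ σ, ((0 : ℤ), (0 : ℤ)) ∈ threeOffsets σ := fun σ => by
    unfold threeOffsets; split_ifs <;> simp
  obtain ⟨k, i, j⟩ := t
  intro v hv
  simp only [Finset.mem_insert, Finset.mem_singleton] at hv
  rw [deck_adj_iff hs]
  rcases hv with rfl | rfl | rfl | rfl | rfl | rfl
  · exact Or.inr (Or.inl ⟨rfl, by simpa using h3 _⟩)
  · exact Or.inr (Or.inr ⟨by simp [sub_eq_add_neg], by simpa using h3 _⟩)
  · exact Or.inl ⟨by simp, by simp [sixOffsets]⟩
  · exact Or.inl ⟨by simp, by simp [sixOffsets]⟩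
  · exact Or.inl ⟨by simp, by simp [sixOffsets]⟩
  · exact Or.inl ⟨by simp, by simp [sixOffsets]⟩

/-- Every commuting square of basic steps has a contact diagonal (which one depends on the letter
`s k` for the squares through the layer step). [folklore] -/
theorem deck_diag {s : ℤ → ℤ} (hs : IsHaggSeq s) (t : ℤ × ℤ × ℤ) :
    (dist bpos[s, t] bpos[s, t + (1, 0, 0) + (0, 1, 0)] = 1 ∨
        dist bpos[s, t + (0, 1, 0)] bpos[s, t + (1, 0, 0)] = 1) ∧
      (dist bpos[s, t] bpos[s, t + (1, 0, 0) + (0, 0, 1)] = 1 ∨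
        dist bpos[s, t + (0, 0, 1)] bpos[s, t + (1, 0, 0)] = 1) ∧
      (dist bpos[s, t] bpos[s, t + (0, 1, 0) + (0, 0, 1)] = 1 ∨
        dist bpos[s, t + (0, 0, 1)] bpos[s, t + (0, 1, 0)] = 1) := by
  have hh : Real.sqrt (2 / 3) ^ 2 = 2 / 3 * (1 : ℝ) ^ 2 := by
    rw [Real.sq_sqrt (by norm_num)]; norm_num
  obtain ⟨k, i, j⟩ := t
  simp only [Prod.mk_add_mk, add_zero, dist_barlowPos_eq_iff hs one_pos hh]
  refine ⟨?_, ?_, Or.inr (Or.inl ⟨trivial, by simp [sixOffsets]⟩)⟩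
  · rcases hs k with h | h
    · exact Or.inr (Or.inr (Or.inl ⟨trivial, by simp [threeOffsets, h]⟩))
    · exact Or.inl (Or.inr (Or.inl ⟨trivial, by simp [threeOffsets, h]⟩))
  · rcases hs k with h | h
    · exact Or.inr (Or.inr (Or.inl ⟨trivial, by simp [threeOffsets, h]⟩))
    · exact Or.inl (Or.inr (Or.inl ⟨trivial, by simp [threeOffsets, h]⟩))

/-- In-layer contacts are words of length `≤ 2` in the unit steps. [folklore] -/
theorem deck_words_six : ∀ PQ ∈ sixOffsets, ((0 : ℤ), -PQ.1, -PQ.2) ∈ U6 ∨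
    ∃ v ∈ U6, ∃ w ∈ U6, ((0 : ℤ), -PQ.1, -PQ.2) = v + w := by
  decide

/-- The adjacent-layer offsets lie among five. [folklore] -/
theorem deck_three_subset (σ : ℤ) :
    threeOffsets σ ⊆ ({(0, 0), (-1, 0), (0, -1), (1, 0), (0, 1)} : Finset (ℤ × ℤ)) := by
  unfold threeOffsets; split_ifs <;> decide

/-- Adjacent-layer contacts are words of length `≤ 2` in the unit steps. [folklore] -/
theorem deck_words_five : ∀ K ∈ ({1, -1} : Finset ℤ),
    ∀ PQ ∈ ({(0, 0), (-1, 0), (0, -1), (1, 0), (0, 1)} : Finset (ℤ × ℤ)),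
      (K, -PQ.1, -PQ.2) ∈ U6 ∨ ∃ v ∈ U6, ∃ w ∈ U6, (K, -PQ.1, -PQ.2) = v + w := by
  decide

/-- **Generation**: every contact of the model is a unit step or a composite of two. [folklore] -/
theorem deck_gen {s : ℤ → ℤ} (hs : IsHaggSeq s) (t u : ℤ × ℤ × ℤ)
    (h : dist bpos[s, t] bpos[s, u] = 1) :
    (∃ v ∈ U6, u = t + v) ∨ ∃ v ∈ U6, ∃ w ∈ U6, u = t + v + w := by
  obtain ⟨k, i, j⟩ := t
  obtain ⟨k', i', j'⟩ := u
  have key : ∀ d : ℤ × ℤ × ℤ, ((k', i', j') : ℤ × ℤ × ℤ) = (k, i, j) + d →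
      (d ∈ U6 ∨ ∃ v ∈ U6, ∃ w ∈ U6, d = v + w) →
      (∃ v ∈ U6, ((k', i', j') : ℤ × ℤ × ℤ) = (k, i, j) + v) ∨
        ∃ v ∈ U6, ∃ w ∈ U6, ((k', i', j') : ℤ × ℤ × ℤ) = (k, i, j) + v + w := by
    rintro d hd' (hd | ⟨v, hv, w, hw, rfl⟩)
    · exact Or.inl ⟨d, hd, hd'⟩
    · exact Or.inr ⟨v, hv, w, hw, by rw [hd', add_assoc]⟩
  rw [deck_adj_iff hs] at h
  rcases h with ⟨hk, hm⟩ | ⟨hk, hm⟩ | ⟨hk, hm⟩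
  · exact key (0, -(i - i'), -(j - j')) (by simp only [Prod.mk_add_mk, Prod.mk.injEq]; omega)
      (deck_words_six _ hm)
  · exact key (1, -(i - i'), -(j - j')) (by simp only [Prod.mk_add_mk, Prod.mk.injEq]; omega)
      (deck_words_five 1 (by simp) _ (deck_three_subset _ hm))
  · exact key (-1, -(i - i'), -(j - j')) (by simp only [Prod.mk_add_mk, Prod.mk.injEq]; omega)
      (deck_words_five (-1) (by simp) _ (deck_three_subset _ hm))

/-! ## The stub -/

/-- **Deck transitivity** (the universal-cover step of the growth descent): for a bond covering
`Ψ : B → S` (star-bijective and link-faithful), a coincidence `Ψ p = Ψ p'` with `p ≠ p'` is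
realised by a fixed-point-free contact automorphism `σ` of the model over `Ψ` with `σ p = p'`.
Proof: unique lifting of the unit steps of `ℤ³` to pairs of sheets; the lifts of the three basic
steps commute (every commuting square splits into two contact triangles, which lift by
link-faithfulness), so they integrate to `σ`; uniqueness of lifts gives bijectivity and
freeness. [folklore] -/
theorem stub_deckTransitive :
    ∀ (S : Set E3) (s : ℤ → ℤ) (Ψ : E3 → E3), IsHaggSeq s → IsBondCovering S s Ψ →
      ∀ p ∈ barlowStacking 1 (Real.sqrt (2 / 3)) s, ∀ p' ∈ barlowStacking 1 (Real.sqrt (2 / 3)) s, Ψ p = Ψ p' → p ≠ p' →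
        ∃ σ : E3 → E3, IsContactAut s σ ∧ (∀ q ∈ barlowStacking 1 (Real.sqrt (2 / 3)) s, Ψ (σ q) = Ψ q) ∧ σ p = p' ∧
          ∀ q ∈ barlowStacking 1 (Real.sqrt (2 / 3)) s, σ q ≠ q := by
  intro S s Ψ hs hcov p hp p' hp' hΨ hne
  obtain ⟨-, -, hstar, hlinks⟩ := hcov
  -- indexing of the model by `ℤ³`
  have hmem : ∀ t : ℤ × ℤ × ℤ, bpos[s, t] ∈ barlowStacking 1 (Real.sqrt (2 / 3)) s :=
    fun t => barlowPos_mem _ _ _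
  have hidx : ∀ q ∈ barlowStacking 1 (Real.sqrt (2 / 3)) s, ∃ t : ℤ × ℤ × ℤ, q = bpos[s, t] :=
    fun q ⟨k, i, j, hq⟩ => ⟨(k, i, j), hq⟩
  have hinjpos : Function.Injective fun t : ℤ × ℤ × ℤ => bpos[s, t] := by
    intro t u h
    by_contra hne'
    have hle := le_dist_barlowPos 1 (Real.sqrt (2 / 3)) s zero_le_one (Real.sqrt_nonneg _)
      (k := t.1) (i := t.2.1) (j := t.2.2) (k' := u.1) (i' := u.2.1) (j' := u.2.2)
      (by simpa [Prod.ext_iff] using hne')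
    have hpos : 0 < min (1 : ℝ) (Real.sqrt (2 / 3)) :=
      lt_min one_pos (Real.sqrt_pos.2 (by norm_num))
    simp only at h
    rw [h, dist_self] at hle
    linarith
  -- the covering axioms in index form
  have hsymm : ∀ t u : ℤ × ℤ × ℤ, dist bpos[s, t] bpos[s, u] = 1 →
      dist bpos[s, u] bpos[s, t] = 1 := fun t u h => by rw [dist_comm]; exact h
  have hinj : ∀ r u₁ u₂ : ℤ × ℤ × ℤ, dist bpos[s, r] bpos[s, u₁] = 1 →
      dist bpos[s, r] bpos[s, u₂] = 1 → Ψ bpos[s, u₁] = Ψ bpos[s, u₂] → u₁ = u₂ :=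
    fun r u₁ u₂ h₁ h₂ h => hinjpos ((hstar _ (hmem r)).injOn ⟨hmem u₁, h₁⟩ ⟨hmem u₂, h₂⟩ h)
  have hsurj : ∀ r r' u : ℤ × ℤ × ℤ, Ψ bpos[s, r] = Ψ bpos[s, r'] →
      dist bpos[s, r] bpos[s, u] = 1 →
      ∃ u' : ℤ × ℤ × ℤ, dist bpos[s, r'] bpos[s, u'] = 1 ∧ Ψ bpos[s, u'] = Ψ bpos[s, u] := by
    intro r r' u hrr' hru
    have hb : Ψ bpos[s, u] ∈ bondNbrs S (Ψ bpos[s, r']) :=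
      hrr' ▸ (hstar _ (hmem r)).mapsTo ⟨hmem u, hru⟩
    obtain ⟨q, ⟨hqB, hqd⟩, hqΨ⟩ := (hstar _ (hmem r')).surjOn hb
    obtain ⟨u', rfl⟩ := hidx q hqB
    exact ⟨u', hqd, hqΨ⟩
  have hlink : ∀ r r' u₁ u₂ u₁' u₂' : ℤ × ℤ × ℤ, dist bpos[s, r] bpos[s, u₁] = 1 →
      dist bpos[s, r] bpos[s, u₂] = 1 → dist bpos[s, r'] bpos[s, u₁'] = 1 →
      dist bpos[s, r'] bpos[s, u₂'] = 1 → Ψ bpos[s, u₁'] = Ψ bpos[s, u₁] →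
      Ψ bpos[s, u₂'] = Ψ bpos[s, u₂] → dist bpos[s, u₁] bpos[s, u₂] = 1 →
      dist bpos[s, u₁'] bpos[s, u₂'] = 1 := by
    intro r r' u₁ u₂ u₁' u₂' h₁ h₂ h₁' h₂' e₁ e₂ h
    have hb : IsBond (Ψ bpos[s, u₁]) (Ψ bpos[s, u₂]) :=
      (hlinks _ (hmem r) _ ⟨hmem u₁, h₁⟩ _ ⟨hmem u₂, h₂⟩).1 h
    exact (hlinks _ (hmem r') _ ⟨hmem u₁', h₁'⟩ _ ⟨hmem u₂', h₂'⟩).2 (by rw [e₁, e₂]; exact hb)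
  -- the deck transformation on indices
  obtain ⟨t₀, rfl⟩ := hidx p hp
  obtain ⟨t₀', rfl⟩ := hidx p' hp'
  have hne₀ : t₀ ≠ t₀' := fun h => hne (by rw [h])
  obtain ⟨ρ, hbij, hiff, hΦρ, hρ₀, hfree⟩ := deck_exists rfl (Φ := fun t : ℤ × ℤ × ℤ => Ψ bpos[s, t])
    (adj := fun t u : ℤ × ℤ × ℤ => dist bpos[s, t] bpos[s, u] = 1) hsymm hinj hsurj hlink
    (deck_unit hs) (fun t => (deck_diag hs t).1) (fun t => (deck_diag hs t).2.1)
    (fun t => (deck_diag hs t).2.2) (deck_gen hs) hΨ hne₀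
  -- transport to `E3` along the indexing
  have hix : ∀ t : ℤ × ℤ × ℤ, Function.invFun (fun t : ℤ × ℤ × ℤ => bpos[s, t]) bpos[s, t] = t :=
    fun t => Function.leftInverse_invFun hinjpos t
  refine ⟨fun q => bpos[s, ρ (Function.invFun (fun t : ℤ × ℤ × ℤ => bpos[s, t]) q)],
    ⟨⟨fun q _ => hmem _, ?_, ?_⟩, ?_⟩, ?_, ?_, ?_⟩
  · intro q₁ hq₁ q₂ hq₂ h
    obtain ⟨t₁, rfl⟩ := hidx q₁ hq₁
    obtain ⟨t₂, rfl⟩ := hidx q₂ hq₂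
    simp only [hix] at h
    rw [hbij.1 (hinjpos h)]
  · intro q hq
    obtain ⟨t, rfl⟩ := hidx q hq
    obtain ⟨t', ht'⟩ := hbij.2 t
    exact ⟨bpos[s, t'], hmem _, by simp only [hix, ht']⟩
  · intro q hq q' hq'
    obtain ⟨t, rfl⟩ := hidx q hq
    obtain ⟨t', rfl⟩ := hidx q' hq'
    simp only [hix]
    exact hiff t t'
  · intro q hq
    obtain ⟨t, rfl⟩ := hidx q hq
    simp only [hix]
    exact hΦρ t
  · simp only [hix, hρ₀]
  · intro q hq
    obtain ⟨t, rfl⟩ := hidx q hq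
    simp only [hix]
    exact fun h => hfree t (hinjpos h)

end Summit.AtomisticToContinuum.Crystallization.Theorems.PalmUnimodularRigidityShellsToBarlowChart

end
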